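/-
Copyright (c) 2026 the pub-hodgecm-mathlib formalisation cell (harness21).  Prover seat hodgecm-mathlib-F0P2-p02 (g27); E1 keeper ∕ dealer F0P3a-p03 (g31), E1 BRICK LEDGER row (O1)
«K4′ JET INTERTWINER» FILE 2a (census `F0/P2/p02/g26/r67/CENSUS-R67-J-ND.v1` 146be52c §3; LEAD T15-52 (B) «PAYDOWN-(J) ROAD FOR K4′»; `hGL` text v1 bd2c149c «=» (O2) side).
-/
import Summits.HodgeConjecture.HodgeConjecture.Theorems.F0P3cStCharTSJetAtDatum       -- ★ J2: `twist_comp_proj_unipotentModel_apply` (brings ★ J1 `exists_linearEquiv_smoothInd_unipotentModel`, `smoothIndRep_unipotentModel_transport`)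
import Literature.NumberTheory.Automorphic.SmoothInductionFrobeniusNaturality           -- ★ FN: `frobeniusNormalized_symm_apply` (brings `frobeniusEquiv`, `normalizedJacquetHomEquiv`, `smoothIndMap`)
import Literature.NumberTheory.Automorphic.JacquetModuleExactProofs                     -- ★ `jacquetMap_exact` (right exactness of `r_P`)
import Literature.RepresentationTheory.JetExtensionRetraction                           -- ★ (O1) FILE 1 p853673: `exists_jet_retraction`, `fst_eq_mul_fst_of_jet_linear`, `fst_eq_zero_of_jacquet_isotypic`
import HarnessLib

/-!
# K4′ jet intertwiner, FILE 2a: FROBENIUS OVER THE DUAL NUMBERS — an `ε`-linear `G`-map `X⁺ = i_P(N₀⁺) → X⁻ = i_P(N₀⁻)` of jet modules from the open-cell isomorphism (GL-jet)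

Cell `pub/hodgecm-mathlib`, crux H413 = `stmt-HodgeConjecture-24833` (`--supports` lane, helper, THEOREMS ONLY: no definition ∕ instance ∕ notation ∕ named fact ∕ `sorry`).
Namespace `Summit.HodgeConjecture.HodgeConjecture.Cruxes.H413.F0P3cStCharTSK4PrimeJetFrobenius`.  E1 BRICK LEDGER row (O1), file 2a of 2 (2b = `F0P3cStCharTSK4PrimeJetIntertwiner`, the
head).  LETTERS (★ D ∕ ★ 46″ frame VERBATIM): `t` a parabolic triple (`[LocallyCompactSpace P]`, `δ_P|_N = 1` — `hδ`), `χ : M →* ℂ` unit-valued (`hχ`) with line `χ₁` (`hχ₁`), `V := SmoothInd t.P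
(χ₁ ∘ proj ⊗ δ^{1/2})`, `I₀ := normalizedInd t χ₁`, `λ` additive (`hlam`) non-zero (`hne`), the jet characters `N₀⁺ = χ₁ ⊗ [[1,0],[λ,1]]` (`hN₀`), `N₀⁻` (`hN₀'`, `−λ`), (GL-jet) = `(ℓ hℓ θ hθM hθE)`:
the open-cell part `ℓ ≤ r_P(i_P N₀⁺)` (classes of sections vanishing at `1`) with an `ε`-LINEAR `M`-ISOMORPHISM `θ : ℓ ≃ N₀⁻` ([BernsteinZelevinsky1977, 2.12], [Casselman1995, Thm. 6.3.5,
L. 7.1.1 (a)] for `ℂ²`-valued sections — ★ `SmoothIndOpenCellHaarIntertwiner` + (O2) FILE B + (O1)-D at the datum; membership proofs ∀-bound; `hθE` for ANY `G`-map lying over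
`E (w₁, w₂) = (0, w₁)`), the height `(Λ hΛ KΛ hKΛ hΛK)` and height jet `(π₁ hπ₁)` of ★ J2, `hss` (`r_P(I₀)` is `χ`-ISOTYPIC — the Jacquet shadow of `I₀ = π⁺ ⊕ π⁻`, ★ `JacquetOfDirectSumIsotypic`),
`hrank` (every additive `β : M → ℂ` vanishing on an open subgroup is `c · λ`, ★ (T2)), and a section `v₁` with `v₁(1) = 1`.
**`exists_epsLinear_jetMap`.**  On `Y = V × V` with the jet actions `J^±(g)(v₀, v₁) = (I₀ g v₀, ±π₁ g v₀ + I₀ g v₁)` (★ J1: `Ψ^± : X^± ≃ Y`) and `ε (v₀, v₁) = (0, v₀)`: (E5) NO LIFT — no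
linear `τ` has `π₁ g v + I₀ g (τ v) = τ (I₀ g v)` (★ `fst_eq_zero_of_jacquet_isotypic` ∘ Frobenius at `I₀`); and there is a linear `𝔄 : Y → Y` with (E1) `𝔄 ∘ J⁺(g) = J⁻(g) ∘ 𝔄`, (E2)
`𝔄 (0, z.1) = (0, (𝔄 z).1)`, (E3) `(𝔄 (v, 0)).1 (1) ≠ 0` for some `v`, (E4) RIGIDITY: every linear `C` commuting with `J⁺(g)` and `ε` has `(C (v, 0)).1 = r₀ • v` (★ `fst_eq_mul_fst_of_jet_linear`).
`𝔄 = Ψ⁻ ∘ E′⁻¹(φ) ∘ (Ψ⁺)⁻¹` where `φ : r_P(X⁺) → N₀⁻` is the `M`-equivariant `ε`-linear retraction of ★ `exists_jet_retraction`, whose hypotheses are discharged here: `ev = E(id)`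
(evaluation at `1`, ★ FN), `e = r_P(i_P E)` (★ `smoothIndMap`, `jacquetMap`), `hss` transported to `r_P(X⁺)` by right exactness (★ `jacquetMap_exact`), smoothness (★ `isSmooth_jacquetModule`).
Elaboration note: one tactic block over `SmoothInd` carriers; `maxHeartbeats 400000` (2× default, measured ≈ 16 s for the file — length, not search; precedent ★ J2 §2∕§3).
[cite: BernsteinZelevinsky1977, Proposition 1.9(b), p. 445; §2.3] [cite: Casselman1995, §6.3; Lemma 7.1.1 (a) p. 67] [cite: Keys1984, §3 pp. 118–119] [cite: Rogawski1990, §12.2 p. 173]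
HONEST LABEL: count-neutral helper at the abstract triple; K4′ shrinks only when FILE 2b + (O2) FILE B + (O1)-D are ★ and the K4′-UNR head closes («to: LEAD»); E1 = PRINT; h413 OPEN; HC_CM is
proved only modulo the 7 printed citations (2 remaining named inputs hLiu418 = stmt-HodgeConjecture-24832, h413 = stmt-HodgeConjecture-24833) until rung 0 closes.
-/

set_option autoImplicit false

set_option linter.dupNamespace false

noncomputable section

open NumberField IsDedekindDomain

namespace Summit.HodgeConjecture.HodgeConjecture.Cruxes.H413.F0P3cStCharTSK4PrimeJetFrobenius

open Literature.NumberTheory.Automorphic Literature.NumberTheory.Automorphic.UnitaryGroup Representation Literature.RepresentationTheory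
open Summit.HodgeConjecture.HodgeConjecture.Cruxes.H413

section AnyTriple


variable {G : Type*} [Group G] [TopologicalSpace G] [IsTopologicalGroup G] (t : ParabolicTriple G) [LocallyCompactSpace ↥t.P]
  (hδ : ∀ (n : G) (hn : n ∈ t.N), deltaChar t.P ⟨n, t.N_le hn⟩ = 1)
  (χ : ↥t.M →* ℂ) (χ₁ : Representation ℂ ↥t.M ℂ) (hχ₁ : ∀ (m : ↥t.M) (x : ℂ), χ₁ m x = χ m * x)
  (lam : ↥t.M → ℂ) (N₀ N₀' : Representation ℂ ↥t.M (ℂ × ℂ))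
  (hN₀ : ∀ (m : ↥t.M) (w : ℂ × ℂ), N₀ m w = (χ₁ m w.1, lam m • χ₁ m w.1 + χ₁ m w.2))
  (hN₀' : ∀ (m : ↥t.M) (w : ℂ × ℂ), N₀' m w = (χ₁ m w.1, (-lam m) • χ₁ m w.1 + χ₁ m w.2))
  -- (GL-jet): the open-cell part `ℓ ≤ r_P(i_P N₀⁺)` is `N₀⁻` — an `M`-equivariant, `ε`-linear isomorphism `θ : ℓ ≃ ℂ × ℂ`
  (ℓ : Submodule ℂ (t.restrict (Representation.normalizedInd t N₀)).Coinvariants)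
  (hℓ : ∀ x, x ∈ ℓ ↔ ∃ f : SmoothInd t.P (Representation.twist (N₀.comp t.proj) (rootDeltaChar t.P)),
    f.toFun 1 = 0 ∧ Coinvariants.mk (t.restrict (Representation.normalizedInd t N₀)) f = x)
  (θ : ↥ℓ ≃ₗ[ℂ] (ℂ × ℂ))
  (hθM : ∀ (m : ↥t.M) (x : (t.restrict (Representation.normalizedInd t N₀)).Coinvariants) (hx : x ∈ ℓ)
    (hmx : (Representation.normalizedInd t N₀).normalizedJacquet t m x ∈ ℓ),
    θ ⟨(Representation.normalizedInd t N₀).normalizedJacquet t m x, hmx⟩ = N₀' m (θ ⟨x, hx⟩))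
  (hθE : ∀ (S : (Representation.normalizedInd t N₀).IntertwiningMap (Representation.normalizedInd t N₀)),
    (∀ (F : SmoothInd t.P (Representation.twist (N₀.comp t.proj) (rootDeltaChar t.P))) (x : G), (S F).toFun x = (0, (F.toFun x).1)) →
    ∀ (x : (t.restrict (Representation.normalizedInd t N₀)).Coinvariants) (hx : x ∈ ℓ) (hSx : jacquetMap t S x ∈ ℓ),
      θ ⟨jacquetMap t S x, hSx⟩ = (0, (θ ⟨x, hx⟩).1))
  -- the height `Λ` of `λ` and the height-jet `π₁` of `I₀ = i_P(χ₁)` (★ J2's letters; hypothesis-style as in ★ D ∕ ★ 46″)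
  (Λ : G → ℂ) (hΛ : ∀ (p : ↥t.P) (g : G), Λ ((p : G) * g) = lam (t.proj p) + Λ g)
  (KΛ : Subgroup G) (hKΛ : IsOpen (KΛ : Set G)) (hΛK : ∀ (x κ : G), κ ∈ KΛ → Λ (x * κ) = Λ x)
  (π₁ : G → Module.End ℂ (SmoothInd t.P (Representation.twist (χ₁.comp t.proj) (rootDeltaChar t.P))))
  (hπ₁ : ∀ (g : G) (w : SmoothInd t.P (Representation.twist (χ₁.comp t.proj) (rootDeltaChar t.P))) (x : G),
    (π₁ g w).toFun x = (Λ (x * g) - Λ x) • w.toFun (x * g))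

set_option maxHeartbeats 400000 in
include hδ hχ₁ hN₀ hN₀' hℓ hθM hθE hΛ hKΛ hΛK hπ₁ in
/-- **§1 FROBENIUS OVER THE DUAL NUMBERS: an `ε`-LINEAR `G`-MAP `𝔄 : X⁺ → X⁻` OF JET MODULES with non-degenerate diagonal block, RIGIDITY of `ε`-linear endomorphisms, and NO LIFT.**
Letters: the ★ D ∕ ★ 46″ frame `(t hδ χ χ₁ hχ₁)`, `λ` additive non-zero (`hlam`, `hne`), the jet characters `N₀^±` (`hN₀`, `hN₀'`), (GL-jet) `(ℓ hℓ θ hθM hθE)` — an `ε`-linear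
`M`-isomorphism of the open-cell part of `r_P(i_P N₀⁺)` onto `N₀⁻` —, the height `(Λ hΛ KΛ hKΛ hΛK)` and height jet `(π₁ hπ₁)`, `hss` (`r_P(I₀)` is `χ`-isotypic), `hrank` (additive rank one:
every additive `β : M → ℂ` vanishing on an open subgroup is `c · λ`), and a section `v₁` of `I₀` with `v₁(1) = 1`.  CONCLUSIONS, on `Y = V × V` with the jet actions
`J^±(g)(v₀, v₁) = (I₀ g v₀, ±π₁ g v₀ + I₀ g v₁)` and `ε (v₀, v₁) = (0, v₀)`: (E5) NO LIFT — no linear `τ : V → V` satisfies `π₁ g v + I₀ g (τ v) = τ (I₀ g v)` (else `v ↦ Ψ⁻¹(v, τ v)` is a `G`-map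
`I₀ → i_P(N₀⁺)` whose Frobenius image `r_P(I₀) → N₀⁺` has non-zero first row, against ★ `fst_eq_zero_of_jacquet_isotypic`); and there is a linear `𝔄 : Y → Y` with (E1) `𝔄 ∘ J⁺(g) = J⁻(g) ∘ 𝔄`,
(E2) `𝔄 (0, z.1) = (0, (𝔄 z).1)`, (E3) `∃ v, (𝔄 (v, 0)).1 (1) ≠ 0`, (E4) for every linear `C : Y → Y` with `C ∘ J⁺(g) = J⁺(g) ∘ C` and `C (0, z.1) = (0, (C z).1)` a scalar `r₀` with
`(C (v, 0)).1 = r₀ • v`.  Construction: `𝔄 = Ψ⁻ ∘ E′⁻¹(φ) ∘ (Ψ⁺)⁻¹` with `φ : r_P(X⁺) → N₀⁻` the retraction of ★ `exists_jet_retraction` (its hypotheses: `ev = E(id)`, `e = r_P(i_P E)`,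
`hss` transported by ★ `jacquetMap_exact`, smoothness ★ `isSmooth_jacquetModule`); (E4) is ★ `fst_eq_mul_fst_of_jet_linear` applied to `E(Ψ⁻¹ ∘ C ∘ Ψ)`.  Budget `maxHeartbeats 400000`
(2× default, measured: ≈ 16 s for the file; length of one tactic block, no search). [cite: BernsteinZelevinsky1977, Proposition 1.9(b), p. 445; §2.3] [cite: Casselman1995, §6.3; Lemma 7.1.1 (a) p. 67]
[cite: Keys1984, §3 pp. 118–119] -/
theorem exists_epsLinear_jetMap (hχ : ∀ m, IsUnit (χ m)) (hlam : ∀ m m', lam (m * m') = lam m + lam m') (hne : ∃ m, lam m ≠ 0)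
    (hss : ∀ (m : ↥t.M) (u : (t.restrict (Representation.normalizedInd t χ₁)).Coinvariants),
      (Representation.normalizedInd t χ₁).normalizedJacquet t m u = χ m • u)
    (hrank : ∀ β : ↥t.M → ℂ, (∀ m m', β (m * m') = β m + β m') →
      (∃ U : Subgroup ↥t.M, IsOpen (U : Set ↥t.M) ∧ ∀ m ∈ U, β m = 0) → ∃ c : ℂ, ∀ m, β m = c * lam m)
    (v₁ : SmoothInd t.P (Representation.twist (χ₁.comp t.proj) (rootDeltaChar t.P))) (hv₁ : v₁.toFun 1 = 1) :
    (∀ tmap : SmoothInd t.P (Representation.twist (χ₁.comp t.proj) (rootDeltaChar t.P)) →ₗ[ℂ] SmoothInd t.P (Representation.twist (χ₁.comp t.proj) (rootDeltaChar t.P)),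
      ¬ ∀ (g : G) (v : SmoothInd t.P (Representation.twist (χ₁.comp t.proj) (rootDeltaChar t.P))), π₁ g v + Representation.normalizedInd t χ₁ g (tmap v) = tmap (Representation.normalizedInd t χ₁ g v)) ∧
    ∃ 𝔄 : (SmoothInd t.P (Representation.twist (χ₁.comp t.proj) (rootDeltaChar t.P)) × SmoothInd t.P (Representation.twist (χ₁.comp t.proj) (rootDeltaChar t.P))) →ₗ[ℂ] (SmoothInd t.P (Representation.twist (χ₁.comp t.proj) (rootDeltaChar t.P)) × SmoothInd t.P (Representation.twist (χ₁.comp t.proj) (rootDeltaChar t.P))),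
      (∀ (g : G) (z : SmoothInd t.P (Representation.twist (χ₁.comp t.proj) (rootDeltaChar t.P)) × SmoothInd t.P (Representation.twist (χ₁.comp t.proj) (rootDeltaChar t.P))),
        𝔄 (Representation.normalizedInd t χ₁ g z.1, π₁ g z.1 + Representation.normalizedInd t χ₁ g z.2) =
          (Representation.normalizedInd t χ₁ g (𝔄 z).1, -(π₁ g (𝔄 z).1) + Representation.normalizedInd t χ₁ g (𝔄 z).2)) ∧
      (∀ z : SmoothInd t.P (Representation.twist (χ₁.comp t.proj) (rootDeltaChar t.P)) × SmoothInd t.P (Representation.twist (χ₁.comp t.proj) (rootDeltaChar t.P)), 𝔄 (0, z.1) = (0, (𝔄 z).1)) ∧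
      (∃ v : SmoothInd t.P (Representation.twist (χ₁.comp t.proj) (rootDeltaChar t.P)), ((𝔄 (v, 0)).1).toFun 1 ≠ 0) ∧
      ∀ C : (SmoothInd t.P (Representation.twist (χ₁.comp t.proj) (rootDeltaChar t.P)) × SmoothInd t.P (Representation.twist (χ₁.comp t.proj) (rootDeltaChar t.P))) →ₗ[ℂ] (SmoothInd t.P (Representation.twist (χ₁.comp t.proj) (rootDeltaChar t.P)) × SmoothInd t.P (Representation.twist (χ₁.comp t.proj) (rootDeltaChar t.P))),
        (∀ (g : G) (z : SmoothInd t.P (Representation.twist (χ₁.comp t.proj) (rootDeltaChar t.P)) × SmoothInd t.P (Representation.twist (χ₁.comp t.proj) (rootDeltaChar t.P))),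
          C (Representation.normalizedInd t χ₁ g z.1, π₁ g z.1 + Representation.normalizedInd t χ₁ g z.2) =
            (Representation.normalizedInd t χ₁ g (C z).1, π₁ g (C z).1 + Representation.normalizedInd t χ₁ g (C z).2)) →
        (∀ z : SmoothInd t.P (Representation.twist (χ₁.comp t.proj) (rootDeltaChar t.P)) × SmoothInd t.P (Representation.twist (χ₁.comp t.proj) (rootDeltaChar t.P)), C (0, z.1) = (0, (C z).1)) →
        ∃ r₀ : ℂ, ∀ v : SmoothInd t.P (Representation.twist (χ₁.comp t.proj) (rootDeltaChar t.P)), (C (v, 0)).1 = r₀ • v := by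
  classical
  -- ### the `P`-level representations `σV = χ₁δ^{1/2}`, `σN = N₀⁺δ^{1/2}`, `σN' = N₀⁻δ^{1/2}` and the jet shapes
  have hsigN : ∀ (p : ↥t.P) (w : ℂ × ℂ), (Representation.twist (N₀.comp t.proj) (rootDeltaChar t.P)) p w = ((Representation.twist (χ₁.comp t.proj) (rootDeltaChar t.P)) p w.1, (fun q : ↥t.P => lam (t.proj q)) p • (Representation.twist (χ₁.comp t.proj) (rootDeltaChar t.P)) p w.1 + (Representation.twist (χ₁.comp t.proj) (rootDeltaChar t.P)) p w.2) :=
    F0P3cStCharTSJetAtDatum.twist_comp_proj_unipotentModel_apply t χ₁ lam N₀ hN₀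
  have hN₀'' : ∀ (m : ↥t.M) (w : ℂ × ℂ), N₀' m w = (χ₁ m w.1, (fun m => -lam m) m • χ₁ m w.1 + χ₁ m w.2) := hN₀'
  have hsigN' : ∀ (p : ↥t.P) (w : ℂ × ℂ), (Representation.twist (N₀'.comp t.proj) (rootDeltaChar t.P)) p w = ((Representation.twist (χ₁.comp t.proj) (rootDeltaChar t.P)) p w.1, (fun q : ↥t.P => -lam (t.proj q)) p • (Representation.twist (χ₁.comp t.proj) (rootDeltaChar t.P)) p w.1 + (Representation.twist (χ₁.comp t.proj) (rootDeltaChar t.P)) p w.2) :=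
    F0P3cStCharTSJetAtDatum.twist_comp_proj_unipotentModel_apply t χ₁ (fun m => -lam m) N₀' hN₀''
  have hΛ' : ∀ (p : ↥t.P) (g : G), (fun g => -Λ g) ((p : G) * g) = (fun q : ↥t.P => -lam (t.proj q)) p + (fun g => -Λ g) g :=
    fun p g => by simp only [hΛ, neg_add]
  have hΛK' : ∀ (x κ : G), κ ∈ KΛ → (fun g => -Λ g) (x * κ) = (fun g => -Λ g) x := fun x κ hκ => by simp only [hΛK x κ hκ]
  have hXsm : (Representation.normalizedInd t N₀).IsSmooth := isSmooth_smoothInd t.P (Representation.twist (N₀.comp t.proj) (rootDeltaChar t.P))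
  -- ### the height trivialisations `Ψ : X⁺ ≃ V × V`, `Ψ' : X⁻ ≃ V × V` (★ J1 (H1)) and the transport of the actions (★ J1 (H3))
  obtain ⟨Ψ, hΨ, hΨs⟩ := exists_linearEquiv_smoothInd_unipotentModel t.P (Representation.twist (χ₁.comp t.proj) (rootDeltaChar t.P)) (fun q : ↥t.P => lam (t.proj q)) (Representation.twist (N₀.comp t.proj) (rootDeltaChar t.P)) hsigN Λ hΛ KΛ hKΛ hΛK
  obtain ⟨Ψ', hΨ', hΨ's⟩ :=
    exists_linearEquiv_smoothInd_unipotentModel t.P (Representation.twist (χ₁.comp t.proj) (rootDeltaChar t.P)) (fun q : ↥t.P => -lam (t.proj q)) (Representation.twist (N₀'.comp t.proj) (rootDeltaChar t.P)) hsigN' (fun g => -Λ g) hΛ' KΛ hKΛ hΛK'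
  have hπ₁' : ∀ (g : G) (w : SmoothInd t.P (Representation.twist (χ₁.comp t.proj) (rootDeltaChar t.P))) (x : G),
      ((fun g => -π₁ g) g w).toFun x = ((fun g => -Λ g) (x * g) - (fun g => -Λ g) x) • w.toFun (x * g) := by
    intro g w x
    rw [show ((fun g => -π₁ g) g w).toFun x = -((π₁ g w).toFun x) from rfl, hπ₁]
    simp only [neg_sub_neg, sub_smul]
    abel
  have hT : ∀ (g : G) (F : SmoothInd t.P (Representation.twist (N₀.comp t.proj) (rootDeltaChar t.P))), Ψ (Representation.normalizedInd t N₀ g F) =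
      (Representation.normalizedInd t χ₁ g (Ψ F).1, π₁ g (Ψ F).1 + Representation.normalizedInd t χ₁ g (Ψ F).2) :=
    fun g F => smoothIndRep_unipotentModel_transport t.P (Representation.twist (χ₁.comp t.proj) (rootDeltaChar t.P)) (Representation.twist (N₀.comp t.proj) (rootDeltaChar t.P)) Λ Ψ hΨ π₁ hπ₁ g F
  have hT' : ∀ (g : G) (F : SmoothInd t.P (Representation.twist (N₀'.comp t.proj) (rootDeltaChar t.P))), Ψ' (Representation.normalizedInd t N₀' g F) =
      (Representation.normalizedInd t χ₁ g (Ψ' F).1, -(π₁ g (Ψ' F).1) + Representation.normalizedInd t χ₁ g (Ψ' F).2) :=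
    fun g F => smoothIndRep_unipotentModel_transport t.P (Representation.twist (χ₁.comp t.proj) (rootDeltaChar t.P)) (Representation.twist (N₀'.comp t.proj) (rootDeltaChar t.P)) (fun g => -Λ g) Ψ' hΨ' (fun g => -π₁ g) hπ₁' g F
  have hTs : ∀ (g : G) (z : SmoothInd t.P (Representation.twist (χ₁.comp t.proj) (rootDeltaChar t.P)) × SmoothInd t.P (Representation.twist (χ₁.comp t.proj) (rootDeltaChar t.P))), Ψ.symm
      (Representation.normalizedInd t χ₁ g z.1, π₁ g z.1 + Representation.normalizedInd t χ₁ g z.2) =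
        Representation.normalizedInd t N₀ g (Ψ.symm z) := by
    intro g z
    apply Ψ.injective
    rw [LinearEquiv.apply_symm_apply, hT, LinearEquiv.apply_symm_apply]
  -- ### the `ε`-operator `εX = i_P(E)` and the projection `fX = i_P(fst) : X⁺ → I₀` (★ `smoothIndMap`), packaged by their pointwise formulas
  obtain ⟨εX, hεX⟩ : ∃ S : (Representation.normalizedInd t N₀).IntertwiningMap (Representation.normalizedInd t N₀),
      ∀ (F : SmoothInd t.P (Representation.twist (N₀.comp t.proj) (rootDeltaChar t.P))) (x : G), (S F).toFun x = (0, (F.toFun x).1) :=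
    ⟨smoothIndMap t.P (LinearMap.intertwiningMap_of_isIntertwiningMap (ρ := (Representation.twist (N₀.comp t.proj) (rootDeltaChar t.P))) (σ := (Representation.twist (N₀.comp t.proj) (rootDeltaChar t.P)))
        ((LinearMap.inr ℂ ℂ ℂ) ∘ₗ LinearMap.fst ℂ ℂ ℂ) (fun p w => by
          change ((0 : ℂ), ((Representation.twist (N₀.comp t.proj) (rootDeltaChar t.P)) p w).1) = (Representation.twist (N₀.comp t.proj) (rootDeltaChar t.P)) p ((0 : ℂ), w.1)
          rw [hsigN, hsigN]
          simp only [map_zero, smul_zero, zero_add])),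
      fun F x => rfl⟩
  obtain ⟨fX, hfX⟩ : ∃ S : (Representation.normalizedInd t N₀).IntertwiningMap (Representation.normalizedInd t χ₁),
      ∀ (F : SmoothInd t.P (Representation.twist (N₀.comp t.proj) (rootDeltaChar t.P))) (x : G), (S F).toFun x = (F.toFun x).1 :=
    ⟨smoothIndMap t.P (LinearMap.intertwiningMap_of_isIntertwiningMap (ρ := (Representation.twist (N₀.comp t.proj) (rootDeltaChar t.P))) (σ := (Representation.twist (χ₁.comp t.proj) (rootDeltaChar t.P))) (LinearMap.fst ℂ ℂ ℂ)
        (fun p w => by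
          change ((Representation.twist (N₀.comp t.proj) (rootDeltaChar t.P)) p w).1 = (Representation.twist (χ₁.comp t.proj) (rootDeltaChar t.P)) p w.1
          rw [hsigN])),
      fun F x => rfl⟩
  -- `Ψ` in terms of `εX`, `fX`
  have hΨε : ∀ F : SmoothInd t.P (Representation.twist (N₀.comp t.proj) (rootDeltaChar t.P)), Ψ (εX F) = (0, (Ψ F).1) := fun F => by
    refine Prod.ext (SmoothInd.ext (funext fun x => ?_)) (SmoothInd.ext (funext fun x => ?_))
    · rw [(hΨ _ x).1, hεX]
      rfl
    · change ((Ψ (εX F)).2).toFun x = ((Ψ F).1).toFun x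
      rw [(hΨ _ x).2, hεX, (hΨ F x).1]
      simp only [smul_zero, sub_zero]
  have hΨsε : ∀ (v w : SmoothInd t.P (Representation.twist (χ₁.comp t.proj) (rootDeltaChar t.P))), Ψ.symm (0, v) = εX (Ψ.symm (v, w)) := fun v w => by
    refine SmoothInd.ext (funext fun x => ?_)
    rw [hΨs, hεX, hΨs]
    refine Prod.ext rfl ?_
    change v.toFun x + Λ x • (0 : SmoothInd t.P (Representation.twist (χ₁.comp t.proj) (rootDeltaChar t.P))).toFun x = v.toFun x
    rw [show (0 : SmoothInd t.P (Representation.twist (χ₁.comp t.proj) (rootDeltaChar t.P))).toFun x = 0 from rfl, smul_zero, add_zero]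
  have hΨsplit : ∀ F : SmoothInd t.P (Representation.twist (N₀.comp t.proj) (rootDeltaChar t.P)), F = Ψ.symm ((Ψ F).1, 0) + εX (Ψ.symm ((Ψ F).2, 0)) := fun F => by
    rw [← hΨsε, ← map_add, Prod.mk_add_mk, add_zero, zero_add, Prod.mk.eta, LinearEquiv.symm_apply_apply]
  -- exactness `range εX = ker fX` and surjectivity of `fX`
  have hexact : Function.Exact εX fX := by
    intro F
    constructor
    · intro hF
      refine ⟨Ψ.symm ((Ψ F).2, 0), ?_⟩
      refine SmoothInd.ext (funext fun x => ?_)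
      rw [hεX, hΨs, (hΨ F x).2]
      have h1 : (F.toFun x).1 = 0 := by
        have h2 := congrArg (fun v : SmoothInd t.P (Representation.twist (χ₁.comp t.proj) (rootDeltaChar t.P)) => v.toFun x) hF
        simp only [hfX] at h2
        exact h2
      refine Prod.ext h1.symm ?_
      change (F.toFun x).2 - Λ x • (F.toFun x).1 = (F.toFun x).2
      rw [h1, smul_zero, sub_zero]
    · rintro ⟨F', rfl⟩
      refine SmoothInd.ext (funext fun x => ?_)
      rw [hfX, hεX]
      rfl
  have hfXsurj : Function.Surjective fX := fun v =>
    ⟨Ψ.symm (v, 0), SmoothInd.ext (funext fun x => by rw [hfX, hΨs])⟩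
  -- ### the Jacquet-module data, packaged by their formulas: `ev = E(id)` (evaluation at `1`), `e = r_P(εX)`
  obtain ⟨ev, hev_mk, hevM⟩ : ∃ ev : (t.restrict (Representation.normalizedInd t N₀)).Coinvariants →ₗ[ℂ] ℂ × ℂ,
      (∀ F : SmoothInd t.P (Representation.twist (N₀.comp t.proj) (rootDeltaChar t.P)), ev (Coinvariants.mk (t.restrict (Representation.normalizedInd t N₀)) F) = F.toFun 1) ∧
      ∀ (m : ↥t.M) (x : (t.restrict (Representation.normalizedInd t N₀)).Coinvariants),
        ev ((Representation.normalizedInd t N₀).normalizedJacquet t m x) = N₀ m (ev x) :=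
    ⟨(((frobeniusEquiv (H := t.P) (σ := (Representation.twist (N₀.comp t.proj) (rootDeltaChar t.P))) (π := Representation.normalizedInd t N₀) hXsm).trans
        (normalizedJacquetHomEquiv t (Representation.normalizedInd t N₀) N₀ hδ)) (IntertwiningMap.id _)).toLinearMap,
      fun F => rfl, fun m x => IntertwiningMap.isIntertwining _ _ _ m x⟩
  have hev : ∀ (m : ↥t.M) (x : (t.restrict (Representation.normalizedInd t N₀)).Coinvariants),
      ev ((Representation.normalizedInd t N₀).normalizedJacquet t m x) = (χ m * (ev x).1, lam m * (χ m * (ev x).1) + χ m * (ev x).2) :=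
    fun m x => by rw [hevM, hN₀, hχ₁, hχ₁, smul_eq_mul]
  obtain ⟨e, he_mk, he_coe⟩ : ∃ e : (t.restrict (Representation.normalizedInd t N₀)).Coinvariants →ₗ[ℂ]
      (t.restrict (Representation.normalizedInd t N₀)).Coinvariants,
      (∀ F : SmoothInd t.P (Representation.twist (N₀.comp t.proj) (rootDeltaChar t.P)), e (Coinvariants.mk (t.restrict (Representation.normalizedInd t N₀)) F) =
        Coinvariants.mk (t.restrict (Representation.normalizedInd t N₀)) (εX F)) ∧
      ∀ w, e w = jacquetMap t εX w :=
    ⟨(jacquetMap t εX).toLinearMap, fun F => rfl, fun w => rfl⟩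
  have hee : ∀ x, e (e x) = 0 := by
    intro x
    obtain ⟨F, rfl⟩ := Coinvariants.mk_surjective _ x
    rw [he_mk, he_mk, show εX (εX F) = 0 from SmoothInd.ext (funext fun y => by rw [hεX, hεX]; rfl), map_zero]
  have her : ∀ (m : ↥t.M) (x : (t.restrict (Representation.normalizedInd t N₀)).Coinvariants),
      e ((Representation.normalizedInd t N₀).normalizedJacquet t m x) = (Representation.normalizedInd t N₀).normalizedJacquet t m (e x) := by
    intro m x
    obtain ⟨F, rfl⟩ := Coinvariants.mk_surjective _ x
    rw [normalizedJacquet_mk, map_smul, he_mk, he_mk, normalizedJacquet_mk, IntertwiningMap.isIntertwining _ _ εX]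
  have heev : ∀ x, ev (e x) = (0, (ev x).1) := fun x => by
    obtain ⟨F, rfl⟩ := Coinvariants.mk_surjective _ x
    rw [he_mk, hev_mk, hev_mk, hεX]
  -- ### the hypotheses of the abstract retraction lemma (★ `JetExtensionRetraction`)
  have hℓ' : ∀ x : (t.restrict (Representation.normalizedInd t N₀)).Coinvariants, x ∈ ℓ ↔ ev x = 0 := by
    intro x
    rw [hℓ]
    constructor
    · rintro ⟨f, hf, rfl⟩
      rw [hev_mk, hf]
    · intro hx
      obtain ⟨f, rfl⟩ := Coinvariants.mk_surjective _ x
      exact ⟨f, by rwa [hev_mk] at hx, rfl⟩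
  have hθM' : ∀ (m : ↥t.M) (x : (t.restrict (Representation.normalizedInd t N₀)).Coinvariants) (hx : x ∈ ℓ)
      (hmx : (Representation.normalizedInd t N₀).normalizedJacquet t m x ∈ ℓ),
      θ ⟨(Representation.normalizedInd t N₀).normalizedJacquet t m x, hmx⟩ =
        (χ m * (θ ⟨x, hx⟩).1, -lam m * (χ m * (θ ⟨x, hx⟩).1) + χ m * (θ ⟨x, hx⟩).2) :=
    fun m x hx hmx => by rw [hθM m x hx hmx, hN₀', hχ₁, hχ₁, smul_eq_mul]
  have hθE' : ∀ (x : (t.restrict (Representation.normalizedInd t N₀)).Coinvariants) (hx : x ∈ ℓ) (hex : e x ∈ ℓ),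
      θ ⟨e x, hex⟩ = (0, (θ ⟨x, hx⟩).1) := by
    intro x hx hex
    have hex' : jacquetMap t εX x ∈ ℓ := by rwa [he_coe] at hex
    have h := hθE εX hεX x hx hex'
    have hsub : (⟨e x, hex⟩ : ↥ℓ) = ⟨jacquetMap t εX x, hex'⟩ := Subtype.ext (he_coe x)
    exact (congrArg θ hsub).trans h
  have hJexact : Function.Exact (jacquetMap t εX) (jacquetMap t fX) := jacquetMap_exact t εX fX hexact hfXsurj
  have hrfX : ∀ (m : ↥t.M) (x : (t.restrict (Representation.normalizedInd t N₀)).Coinvariants),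
      jacquetMap t fX ((Representation.normalizedInd t N₀).normalizedJacquet t m x) =
        (Representation.normalizedInd t χ₁).normalizedJacquet t m (jacquetMap t fX x) := by
    intro m x
    change jacquetMap t fX ((((Representation.normalizedInd t N₀).jacquetModule t).twist ((rootDeltaChar t.P)⁻¹.comp (Subgroup.inclusion t.M_le))) m x) =
      (((Representation.normalizedInd t χ₁).jacquetModule t).twist ((rootDeltaChar t.P)⁻¹.comp (Subgroup.inclusion t.M_le))) m (jacquetMap t fX x)
    have hint : jacquetMap t fX (((Representation.normalizedInd t N₀).jacquetModule t) m x) =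
        ((Representation.normalizedInd t χ₁).jacquetModule t) m (jacquetMap t fX x) :=
      IntertwiningMap.isIntertwining _ _ (jacquetMap t fX) m x
    simp only [Representation.twist_apply, map_smul, hint]
  have hssF : ∀ (m : ↥t.M) (x : (t.restrict (Representation.normalizedInd t N₀)).Coinvariants),
      ∃ y, (Representation.normalizedInd t N₀).normalizedJacquet t m x - χ m • x = e y := by
    intro m x
    have h0 : jacquetMap t fX ((Representation.normalizedInd t N₀).normalizedJacquet t m x - χ m • x) = 0 := by
      simp only [map_sub, map_smul, hrfX, hss, sub_self]
    have hmem := (hJexact ((Representation.normalizedInd t N₀).normalizedJacquet t m x - χ m • x)).1 h0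
    exact (Set.mem_range.1 hmem).imp fun y hy => hy.symm.trans (he_coe y).symm
  have hsmF : ∀ x : (t.restrict (Representation.normalizedInd t N₀)).Coinvariants,
      ∃ U : Subgroup ↥t.M, IsOpen (U : Set ↥t.M) ∧ ∀ m ∈ U, ∃ d : ℂ, (Representation.normalizedInd t N₀).normalizedJacquet t m x = d • x := by
    intro x
    refine ⟨((Representation.normalizedInd t N₀).jacquetModule t).stabilizerSubgroup x,
      isSmooth_jacquetModule (Representation.normalizedInd t N₀) t hXsm x, fun m hm => ?_⟩
    rw [mem_stabilizerSubgroup] at hm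
    refine ⟨(((rootDeltaChar t.P)⁻¹.comp (Subgroup.inclusion t.M_le) m : ℂˣ) : ℂ), ?_⟩
    change (((Representation.normalizedInd t N₀).jacquetModule t).twist ((rootDeltaChar t.P)⁻¹.comp (Subgroup.inclusion t.M_le))) m x = _
    rw [Representation.twist_apply, hm]
  -- a lift of `(1, 0)` under `ev`: the class of `Ψ⁻¹ (v₁, -Λ(1) v₁)`
  have h1F : ∃ x₁ : (t.restrict (Representation.normalizedInd t N₀)).Coinvariants, ev x₁ = (1, 0) := by
    refine ⟨Coinvariants.mk _ (Ψ.symm (v₁, -(Λ 1 • v₁))), ?_⟩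
    rw [hev_mk, hΨs, hv₁]
    refine Prod.ext rfl ?_
    change (-(Λ 1 • v₁)).toFun 1 + Λ 1 • (1 : ℂ) = 0
    rw [show (-(Λ 1 • v₁)).toFun 1 = -(Λ 1 • v₁.toFun 1) from rfl, hv₁]
    ring
  -- ### THE RETRACTION `φ : r_P(X⁺) → N₀⁻` (★ `exists_jet_retraction`)
  obtain ⟨φ, hφM, hφE, hφθ⟩ := exists_jet_retraction ((Representation.normalizedInd t N₀).normalizedJacquet t) χ lam ev e ℓ hℓ'
    hχ hlam hev h1F hee her heev θ hθM' hθE' hssF hsmF hrank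
  -- ### (E5) NO LIFT: `I₀` does not lift into `X⁺` (★ `fst_eq_zero_of_jacquet_isotypic` + Frobenius at `I₀`)
  have hIsm : (Representation.normalizedInd t χ₁).IsSmooth := isSmooth_smoothInd t.P (Representation.twist (χ₁.comp t.proj) (rootDeltaChar t.P))
  refine ⟨fun tmap htmap => ?_, ?_⟩
  · obtain ⟨sI, hsI⟩ : ∃ S : (Representation.normalizedInd t χ₁).IntertwiningMap (Representation.normalizedInd t N₀),
        ∀ v : SmoothInd t.P (Representation.twist (χ₁.comp t.proj) (rootDeltaChar t.P)), S v = Ψ.symm (v, tmap v) :=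
      ⟨LinearMap.intertwiningMap_of_isIntertwiningMap (ρ := Representation.normalizedInd t χ₁) (σ := Representation.normalizedInd t N₀)
          (Ψ.symm.toLinearMap ∘ₗ LinearMap.prod LinearMap.id tmap) (fun g v => by
            change Ψ.symm (Representation.normalizedInd t χ₁ g v, tmap (Representation.normalizedInd t χ₁ g v)) =
              Representation.normalizedInd t N₀ g (Ψ.symm (v, tmap v))
            rw [← htmap g v, ← hTs g (v, tmap v)]),
        fun v => rfl⟩
    obtain ⟨μ, hμ_mk, hμM⟩ : ∃ μ : (t.restrict (Representation.normalizedInd t χ₁)).Coinvariants →ₗ[ℂ] ℂ × ℂ,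
        (∀ v : SmoothInd t.P (Representation.twist (χ₁.comp t.proj) (rootDeltaChar t.P)), μ (Coinvariants.mk (t.restrict (Representation.normalizedInd t χ₁)) v) = (sI v).toFun 1) ∧
        ∀ (m : ↥t.M) (u : (t.restrict (Representation.normalizedInd t χ₁)).Coinvariants),
          μ ((Representation.normalizedInd t χ₁).normalizedJacquet t m u) = N₀ m (μ u) :=
      ⟨(((frobeniusEquiv (H := t.P) (σ := (Representation.twist (N₀.comp t.proj) (rootDeltaChar t.P))) (π := Representation.normalizedInd t χ₁) hIsm).trans
          (normalizedJacquetHomEquiv t (Representation.normalizedInd t χ₁) N₀ hδ)) sI).toLinearMap,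
        fun v => rfl, fun m u => IntertwiningMap.isIntertwining _ _ _ m u⟩
    have hμM' : ∀ (m : ↥t.M) (u : (t.restrict (Representation.normalizedInd t χ₁)).Coinvariants),
        μ ((Representation.normalizedInd t χ₁).normalizedJacquet t m u) = (χ m * (μ u).1, lam m * (χ m * (μ u).1) + χ m * (μ u).2) :=
      fun m u => by rw [hμM, hN₀, hχ₁, hχ₁, smul_eq_mul]
    have h0 := fst_eq_zero_of_jacquet_isotypic χ lam ((Representation.normalizedInd t χ₁).normalizedJacquet t) hχ hne hss μ hμM'
      (Coinvariants.mk (t.restrict (Representation.normalizedInd t χ₁)) v₁)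
    rw [hμ_mk, hsI, hΨs, hv₁] at h0
    exact one_ne_zero h0
  -- ### the Frobenius image `𝔄₀ = E'⁻¹(φ) : X⁺ → X⁻` and its transport `𝔄 = Ψ' ∘ 𝔄₀ ∘ Ψ⁻¹` to `V × V`
  obtain ⟨φI, hφI⟩ : ∃ T : ((Representation.normalizedInd t N₀).normalizedJacquet t).IntertwiningMap N₀',
      ∀ x, T x = φ x :=
    ⟨LinearMap.intertwiningMap_of_isIntertwiningMap (ρ := (Representation.normalizedInd t N₀).normalizedJacquet t) (σ := N₀') φ
        (fun m x => by rw [hφM, hN₀', hχ₁, hχ₁, smul_eq_mul]), fun x => rfl⟩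
  obtain ⟨𝔄₀, h𝔄₀⟩ : ∃ A : (Representation.normalizedInd t N₀).IntertwiningMap (Representation.normalizedInd t N₀'),
      ∀ (x : SmoothInd t.P (Representation.twist (N₀.comp t.proj) (rootDeltaChar t.P))) (g : G), (A x).toFun g =
        φ (Coinvariants.mk (t.restrict (Representation.normalizedInd t N₀)) (Representation.normalizedInd t N₀ g x)) :=
    ⟨((frobeniusEquiv (H := t.P) (σ := (Representation.twist (N₀'.comp t.proj) (rootDeltaChar t.P))) (π := Representation.normalizedInd t N₀) hXsm).trans
        (normalizedJacquetHomEquiv t (Representation.normalizedInd t N₀) N₀' hδ)).symm φI,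
      fun x g => (frobeniusNormalized_symm_apply t N₀' hXsm hδ φI x g).trans (hφI _)⟩
  obtain ⟨𝔄, h𝔄⟩ : ∃ A : (SmoothInd t.P (Representation.twist (χ₁.comp t.proj) (rootDeltaChar t.P)) × SmoothInd t.P (Representation.twist (χ₁.comp t.proj) (rootDeltaChar t.P))) →ₗ[ℂ] (SmoothInd t.P (Representation.twist (χ₁.comp t.proj) (rootDeltaChar t.P)) × SmoothInd t.P (Representation.twist (χ₁.comp t.proj) (rootDeltaChar t.P))),
      ∀ z, A z = Ψ' (𝔄₀ (Ψ.symm z)) :=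
    ⟨Ψ'.toLinearMap ∘ₗ 𝔄₀.toLinearMap ∘ₗ Ψ.symm.toLinearMap, fun z => rfl⟩
  have hK1 : ∀ (z : SmoothInd t.P (Representation.twist (χ₁.comp t.proj) (rootDeltaChar t.P)) × SmoothInd t.P (Representation.twist (χ₁.comp t.proj) (rootDeltaChar t.P))) (g : G), ((𝔄 z).1).toFun g =
      (φ (Coinvariants.mk (t.restrict (Representation.normalizedInd t N₀)) (Representation.normalizedInd t N₀ g (Ψ.symm z)))).1 :=
    fun z g => by rw [h𝔄, (hΨ' _ g).1, h𝔄₀]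
  -- `𝔄₀` commutes with `ε`: `Ψ' (𝔄₀ (εX x)) = (0, (Ψ' (𝔄₀ x)).1)`
  have hAε : ∀ x : SmoothInd t.P (Representation.twist (N₀.comp t.proj) (rootDeltaChar t.P)), Ψ' (𝔄₀ (εX x)) = (0, (Ψ' (𝔄₀ x)).1) := by
    intro x
    have hpt : ∀ g : G, (𝔄₀ (εX x)).toFun g = (0, ((𝔄₀ x).toFun g).1) := fun g => by
      rw [h𝔄₀, h𝔄₀, ← IntertwiningMap.isIntertwining _ _ εX g x, ← he_mk, hφE]
    refine Prod.ext (SmoothInd.ext (funext fun g => ?_)) (SmoothInd.ext (funext fun g => ?_))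
    · rw [(hΨ' _ g).1, hpt]
      rfl
    · change _ = ((Ψ' (𝔄₀ x)).1).toFun g
      rw [(hΨ' _ g).2, hpt, (hΨ' _ g).1]
      simp only [smul_zero, sub_zero]
  refine ⟨𝔄, fun g z => ?_, fun z => ?_, ?_, fun C hC1 hC2 => ?_⟩
  · -- (E1) equivariance `𝔄 ∘ J⁺(g) = J⁻(g) ∘ 𝔄`
    rw [h𝔄, h𝔄, hTs, IntertwiningMap.isIntertwining _ _ 𝔄₀, hT']
  · -- (E2) `ε`-linearity
    rw [h𝔄, h𝔄, hΨsε z.1 z.2, Prod.mk.eta, hAε]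
  · -- (E3) non-degeneracy: at the open-cell generator `s = θ⁻¹(1, 0)` the diagonal block has `(𝔄₁₁ v)(1) = 1`
    obtain ⟨F, hF⟩ := Coinvariants.mk_surjective (t.restrict (Representation.normalizedInd t N₀)) ((θ.symm (1, 0) : ↥ℓ) : _)
    refine ⟨(Ψ F).1, ?_⟩
    have hmk : Coinvariants.mk (t.restrict (Representation.normalizedInd t N₀)) (Ψ.symm ((Ψ F).1, 0)) =
        Coinvariants.mk (t.restrict (Representation.normalizedInd t N₀)) F -
          e (Coinvariants.mk (t.restrict (Representation.normalizedInd t N₀)) (Ψ.symm ((Ψ F).2, 0))) := by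
      have h := congrArg (Coinvariants.mk (t.restrict (Representation.normalizedInd t N₀))) (hΨsplit F)
      rw [map_add, ← he_mk] at h
      exact eq_sub_of_add_eq h.symm
    rw [hK1, map_one, Module.End.one_apply, hmk, map_sub, hφE, hF, hφθ _ (θ.symm (1, 0)).2, Subtype.coe_eta,
      LinearEquiv.apply_symm_apply]
    simp only [Prod.fst_sub, sub_zero, ne_eq, one_ne_zero, not_false_eq_true]
  · -- (E4) rigidity of `ε`-linear `G`-endomorphisms of `X⁺`: `C₀ = Ψ⁻¹ ∘ C ∘ Ψ`, `ψ = E(C₀)`, ★ `fst_eq_mul_fst_of_jet_linear`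
    obtain ⟨C₀, hC₀⟩ : ∃ T : (Representation.normalizedInd t N₀).IntertwiningMap (Representation.normalizedInd t N₀),
        ∀ x, T x = Ψ.symm (C (Ψ x)) :=
      ⟨LinearMap.intertwiningMap_of_isIntertwiningMap (ρ := Representation.normalizedInd t N₀) (σ := Representation.normalizedInd t N₀)
          (Ψ.symm.toLinearMap ∘ₗ C ∘ₗ Ψ.toLinearMap) (fun g x => by
            change Ψ.symm (C (Ψ (Representation.normalizedInd t N₀ g x))) = Representation.normalizedInd t N₀ g (Ψ.symm (C (Ψ x)))
            rw [hT, hC1 g (Ψ x), hTs]),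
        fun x => rfl⟩
    have hΨC₀ : ∀ x, Ψ (C₀ x) = C (Ψ x) := fun x => by rw [hC₀, LinearEquiv.apply_symm_apply]
    obtain ⟨ψ, hψ_mk, hψM, hψC₀⟩ : ∃ ψ : (t.restrict (Representation.normalizedInd t N₀)).Coinvariants →ₗ[ℂ] ℂ × ℂ,
        (∀ F : SmoothInd t.P (Representation.twist (N₀.comp t.proj) (rootDeltaChar t.P)), ψ (Coinvariants.mk (t.restrict (Representation.normalizedInd t N₀)) F) = (C₀ F).toFun 1) ∧
        (∀ (m : ↥t.M) (x : (t.restrict (Representation.normalizedInd t N₀)).Coinvariants),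
          ψ ((Representation.normalizedInd t N₀).normalizedJacquet t m x) = N₀ m (ψ x)) ∧
        ∀ (x : SmoothInd t.P (Representation.twist (N₀.comp t.proj) (rootDeltaChar t.P))) (g : G), (C₀ x).toFun g =
          ψ (Coinvariants.mk (t.restrict (Representation.normalizedInd t N₀)) (Representation.normalizedInd t N₀ g x)) := by
      refine ⟨(((frobeniusEquiv (H := t.P) (σ := (Representation.twist (N₀.comp t.proj) (rootDeltaChar t.P))) (π := Representation.normalizedInd t N₀) hXsm).trans
          (normalizedJacquetHomEquiv t (Representation.normalizedInd t N₀) N₀ hδ)) C₀).toLinearMap,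
        fun F => rfl, fun m x => IntertwiningMap.isIntertwining _ _ _ m x, fun x g => ?_⟩
      have h := frobeniusNormalized_symm_apply t N₀ hXsm hδ
        (((frobeniusEquiv (H := t.P) (σ := (Representation.twist (N₀.comp t.proj) (rootDeltaChar t.P))) (π := Representation.normalizedInd t N₀) hXsm).trans
          (normalizedJacquetHomEquiv t (Representation.normalizedInd t N₀) N₀ hδ)) C₀) x g
      rw [LinearEquiv.symm_apply_apply] at h
      exact h
    have hψM' : ∀ (m : ↥t.M) (x : (t.restrict (Representation.normalizedInd t N₀)).Coinvariants),
        ψ ((Representation.normalizedInd t N₀).normalizedJacquet t m x) = (χ m * (ψ x).1, lam m * (χ m * (ψ x).1) + χ m * (ψ x).2) :=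
      fun m x => by rw [hψM, hN₀, hχ₁, hχ₁, smul_eq_mul]
    have hψE : ∀ x, ψ (e x) = (0, (ψ x).1) := by
      intro x
      obtain ⟨F, rfl⟩ := Coinvariants.mk_surjective _ x
      have hCε : C₀ (εX F) = εX (C₀ F) := by
        rw [hC₀, hΨε, hC2 (Ψ F), hΨsε (C (Ψ F)).1 (C (Ψ F)).2, Prod.mk.eta, ← hC₀]
      rw [he_mk, hψ_mk, hψ_mk, hCε, hεX]
    obtain ⟨r₀, hr₀⟩ := fst_eq_mul_fst_of_jet_linear ((Representation.normalizedInd t N₀).normalizedJacquet t) χ lam ev e ℓ hℓ'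
      hχ hne hev h1F heev θ hθM' hθE' ψ hψM' hψE
    refine ⟨r₀, fun v => SmoothInd.ext (funext fun g => ?_)⟩
    have hXap : ∀ (g : G) (F : SmoothInd t.P (Representation.twist (N₀.comp t.proj) (rootDeltaChar t.P))) (x : G), (Representation.normalizedInd t N₀ g F).toFun x = F.toFun (x * g) :=
      fun g F x => rfl
    rw [← LinearEquiv.apply_symm_apply Ψ (v, 0), ← hΨC₀, (hΨ _ g).1, hψC₀, hr₀, hev_mk, hXap, one_mul, hΨs,
      SmoothInd.toFun_smul, Pi.smul_apply, smul_eq_mul]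
    rfl

end AnyTriple

end Summit.HodgeConjecture.HodgeConjecture.Cruxes.H413.F0P3cStCharTSK4PrimeJetFrobenius

end
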